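import Mathlib.Analysis.SpecialFunctions.Log.Monotone
import Summits.RiemannHypothesis.RiemannHypothesis.Theses.LiAsymptotic
import Summits.RiemannHypothesis.RiemannHypothesis.Theorems.LiAsymptoticDefs
import Summits.RiemannHypothesis.RiemannHypothesis.Theorems.LiCoefficientsLiFarZeroTail
import HarnessLib

/-!
# RiemannHypothesis / LiAsymptotic — item `LiAsymptoticBudget` (crux K4; a closed real inequality)

Route `RiemannHypothesis/LiAsymptotic`, item `LiAsymptoticBudget` (stmt-RiemannHypothesis-19165): `liAsymptoticBudget_proof`.
RH-FREE [rh-li-prover].  Crux K4 of the rung L-P(P1⁺) «Li asymptotic law, quadratic range» (route dossier `LiAsymptotic`,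
cell `pub/rh-li`, theory memo `theory/TARGETS.md` §11.2 STEP 8): for `T ≥ 1000` and `n ≤ T²/4`,

* `n ≥ 900`:   `liErrFar n T + liErrLow n + liErrSmooth n + liErrOscPlain n ≤ 2 √n log n`;
* `n ≥ 3·10⁵`: `liErrFar n T + liErrLow n + liErrSmooth n + liErrOsc n ≤ (1/3) √n log n`.

With `s = √n`, `L = log n`: `liErrFar n T ≤ 0.00936 sL + 0.013 s + 0.005 L + 0.007` on the whole admissible
region (`T ≥ 2s ≥ 60 ≥ e`, `log T/T` is decreasing on `[e, ∞)` — `Real.log_div_self_antitoneOn` — and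
`1/T ≤ 1/(2s)`), `liErrLow n ≤ 0.15916 sL − 0.89 s + 0.6166 L + 16.512` (`log 2π ≥ 1.8`), and the remaining sums are
linear in `sL, s, L, 1`; the budgets close by `L ≥ 6.75` (`n ≥ 900`) resp. `L ≥ 12.5`, `s ≥ 547` (`n ≥ 3·10⁵`)
with margins `1.18 ≤ 1.52` resp. `0.054 ≤ 0.122` in the `sL`-coefficient (theory's float sup: 0.818 resp. 0.792).
Nothing here bears on the truth of RH.
-/

noncomputable section

-- D-0017: `Summit.<S>.<S>.…` is the designed namespace of a single-problem summit.
set_option linter.dupNamespace false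

open Real Set

namespace Summit.RiemannHypothesis.RiemannHypothesis.Theorems.LiTheory

open Literature.NumberTheory.LFunctions

namespace Budget

/-- `log 900 ≥ 6.75` (`e^{27} < 900⁴`). -/
theorem log_900_ge : (6.75 : ℝ) ≤ Real.log 900 := by
  rw [Real.le_log_iff_exp_le (by norm_num)]
  have he := Real.exp_one_lt_d9
  have h4 : Real.exp 6.75 ^ 4 = Real.exp 1 ^ 27 := by
    rw [← Real.exp_nat_mul, ← Real.exp_nat_mul]; norm_num
  have hlt : Real.exp 6.75 ^ 4 < 900 ^ 4 := by
    rw [h4]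
    calc Real.exp 1 ^ 27 < 2.7182818286 ^ 27 := pow_lt_pow_left₀ he (Real.exp_pos 1).le (by norm_num)
      _ < 900 ^ 4 := by norm_num
  exact (lt_of_pow_lt_pow_left₀ 4 (by norm_num) hlt).le

/-- `log 300000 ≥ 12.5` (`e^{25} < (3·10⁵)²`). -/
theorem log_300000_ge : (12.5 : ℝ) ≤ Real.log 300000 := by
  rw [Real.le_log_iff_exp_le (by norm_num)]
  have he := Real.exp_one_lt_d9
  have h2 : Real.exp 12.5 ^ 2 = Real.exp 1 ^ 25 := by
    rw [← Real.exp_nat_mul, ← Real.exp_nat_mul]; norm_num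
  have hlt : Real.exp 12.5 ^ 2 < 300000 ^ 2 := by
    rw [h2]
    calc Real.exp 1 ^ 25 < 2.7182818286 ^ 25 := pow_lt_pow_left₀ he (Real.exp_pos 1).le (by norm_num)
      _ < 300000 ^ 2 := by norm_num
  exact (lt_of_pow_lt_pow_left₀ 2 (by norm_num) hlt).le

/-- The FAR term on the admissible region: for `n ≥ 900` and `n ≤ T²/4`,
`liErrFar n T ≤ 0.00936 √n log n + 0.013 √n + 0.005 log n + 0.007`. -/
theorem liErrFar_le {n : ℕ} {T : ℝ} (hn : 900 ≤ n) (hnc : (n : ℝ) ≤ 1 / 4 * T ^ 2) (hT : 0 < T) :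
    liErrFar n T ≤ 0.00936 * Real.sqrt n * Real.log n + 0.013 * Real.sqrt n + 0.005 * Real.log n + 0.007 := by
  have hπ := Real.pi_gt_d4
  have hnR : (900 : ℝ) ≤ n := by exact_mod_cast hn
  have hn0 : (0 : ℝ) ≤ n := by positivity
  set s := Real.sqrt n with hs
  set L := Real.log n with hL
  have hs2 : s ^ 2 = n := Real.sq_sqrt hn0
  have hs30 : 30 ≤ s := by
    rw [hs, show (30 : ℝ) = Real.sqrt (30 ^ 2) by rw [Real.sqrt_sq (by norm_num)]]
    exact Real.sqrt_le_sqrt (by linarith)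
  have hs0 : 0 < s := by linarith
  have hlogs : Real.log s = L / 2 := by rw [hs, Real.log_sqrt hn0]
  -- `T ≥ 2s`
  have hT2s : 2 * s ≤ T := by
    have : (2 * s) ^ 2 ≤ T ^ 2 := by nlinarith
    nlinarith [sq_nonneg (T - 2 * s), sq_nonneg (T + 2 * s)]
  -- `log T/T ≤ log(2s)/(2s)`
  have he1 : Real.exp 1 ≤ 2 * s := by
    have := Real.exp_one_lt_d9; linarith
  have hanti := Real.log_div_self_antitoneOn he1 (he1.trans hT2s) hT2s
  simp only at hanti
  have hlog2s : Real.log (2 * s) ≤ 0.6932 + L / 2 := by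
    rw [Real.log_mul two_ne_zero hs0.ne', hlogs]
    linarith [Real.log_two_lt_d9]
  have hq : Real.log T / T ≤ (0.6932 + L / 2) / (2 * s) :=
    hanti.trans (div_le_div_of_nonneg_right hlog2s (by linarith))
  have hL0 : 0 ≤ L := Real.log_nonneg (by linarith)
  have hq0 : 0 ≤ Real.log T / T := div_nonneg (Real.log_nonneg (by linarith)) hT.le
  -- Term 1: `2.82 n² log T/(6πT³) = (2.82 n²/(6π)) (log T/T) (1/T²)`, `1/T² ≤ 1/(4n)`
  have hT2 : (1 : ℝ) / T ^ 2 ≤ 1 / (4 * s ^ 2) := by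
    apply div_le_div_of_nonneg_left zero_le_one (by positivity)
    nlinarith
  have h1 : 2.82 * (n : ℝ) ^ 2 * (Real.log T / (6 * π * T ^ 3)) ≤
      2.82 / (48 * π) * s * (0.6932 + L / 2) := by
    have e : 2.82 * (n : ℝ) ^ 2 * (Real.log T / (6 * π * T ^ 3)) =
        2.82 * (n : ℝ) ^ 2 / (6 * π) * ((Real.log T / T) * (1 / T ^ 2)) := by
      field_simp
    rw [e]
    have hprod : (Real.log T / T) * (1 / T ^ 2) ≤ ((0.6932 + L / 2) / (2 * s)) * (1 / (4 * s ^ 2)) :=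
      mul_le_mul hq hT2 (by positivity) (by positivity)
    calc 2.82 * (n : ℝ) ^ 2 / (6 * π) * ((Real.log T / T) * (1 / T ^ 2))
        ≤ 2.82 * (n : ℝ) ^ 2 / (6 * π) * (((0.6932 + L / 2) / (2 * s)) * (1 / (4 * s ^ 2))) :=
          mul_le_mul_of_nonneg_left hprod (by positivity)
      _ = 2.82 / (48 * π) * s * (0.6932 + L / 2) := by
          rw [← hs2]; field_simp; ring
  -- Term 2: `(n/2) log T/(4πT²) = (n/(8π)) (log T/T) (1/T)`, `1/T ≤ 1/(2s)`
  have hT1 : (1 : ℝ) / T ≤ 1 / (2 * s) := div_le_div_of_nonneg_left zero_le_one (by positivity) hT2s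
  have h2 : (n : ℝ) / 2 * (Real.log T / (4 * π * T ^ 2)) ≤ (0.6932 + L / 2) / (32 * π) := by
    have e : (n : ℝ) / 2 * (Real.log T / (4 * π * T ^ 2)) =
        (n : ℝ) / (8 * π) * ((Real.log T / T) * (1 / T)) := by
      field_simp
      ring
    rw [e]
    have hprod : (Real.log T / T) * (1 / T) ≤ ((0.6932 + L / 2) / (2 * s)) * (1 / (2 * s)) :=
      mul_le_mul hq hT1 (by positivity) (by positivity)
    calc (n : ℝ) / (8 * π) * ((Real.log T / T) * (1 / T))
        ≤ (n : ℝ) / (8 * π) * (((0.6932 + L / 2) / (2 * s)) * (1 / (2 * s))) :=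
          mul_le_mul_of_nonneg_left hprod (by positivity)
      _ = (0.6932 + L / 2) / (32 * π) := by
          rw [← hs2]; field_simp; ring
  -- numerics
  have hc1 : 2.82 / (48 * π) ≤ 0.018702 := by
    rw [div_le_iff₀ (by positivity)]; nlinarith [Real.pi_gt_d4]
  have hc2 : (0.6932 + L / 2) / (32 * π) ≤ (0.6932 + L / 2) / 100.5 :=
    div_le_div_of_nonneg_left (by positivity) (by norm_num) (by nlinarith [Real.pi_gt_d4])
  have hsL : 0 ≤ s * (0.6932 + L / 2) := by positivity
  unfold liErrFar
  calc 2.82 * (n : ℝ) ^ 2 * (Real.log T / (6 * π * T ^ 3)) + (n : ℝ) / 2 * (Real.log T / (4 * π * T ^ 2))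
      ≤ 2.82 / (48 * π) * s * (0.6932 + L / 2) + (0.6932 + L / 2) / (32 * π) := add_le_add h1 h2
    _ ≤ 0.018702 * (s * (0.6932 + L / 2)) + (0.6932 + L / 2) / 100.5 := by
        rw [mul_assoc]
        exact add_le_add (mul_le_mul_of_nonneg_right hc1 hsL) hc2
    _ ≤ 0.00936 * s * L + 0.013 * s + 0.005 * L + 0.007 := by
        have hsL0 : 0 ≤ s * L := by positivity
        have e : 0.018702 * (s * (0.6932 + L / 2)) + (0.6932 + L / 2) / 100.5 =
            0.018702 * 0.6932 * s + 0.018702 / 2 * (s * L) + 0.6932 / 100.5 + L / 201 := by ring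
        rw [e]
        nlinarith [hsL0, hs0.le, hL0]

/-- The LOW term: `liErrLow n ≤ 0.15916 √n log n − 0.89 √n + 0.6166 log n + 16.512` (`n ≥ 1`). -/
theorem liErrLow_le {n : ℕ} (hn : 1 ≤ n) :
    liErrLow n ≤ 0.15916 * Real.sqrt n * Real.log n - 0.89 * Real.sqrt n + 0.6166 * Real.log n + 16.512 := by
  have hπ := Real.pi_gt_d4
  have hπ' := Real.pi_lt_d4
  have hnR : (1 : ℝ) ≤ n := by exact_mod_cast hn
  have hn0 : (0 : ℝ) ≤ n := by positivity
  set s := Real.sqrt n with hs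
  set L := Real.log n with hL
  have hs0 : 0 < s := Real.sqrt_pos.2 (by linarith)
  have hlogs : Real.log s = L / 2 := by rw [hs, Real.log_sqrt hn0]
  have hL0 : 0 ≤ L := Real.log_nonneg hnR
  have h2π := FarZeroTail.log_two_pi_ge
  have hmain : liCountMain s = s / (2 * π) * (L / 2 - Real.log (2 * π) - 1) := by
    unfold liCountMain
    rw [Real.log_div hs0.ne' (by positivity), Real.log_mul (by positivity) (Real.exp_ne_zero 1),
      Real.log_exp, hlogs]
    ring
  unfold liErrLow
  rw [hmain, hlogs]
  have hA : 2 * (s / (2 * π) * (L / 2 - Real.log (2 * π) - 1)) =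
      (s * L / 2 - s * (Real.log (2 * π) + 1)) / π := by
    field_simp
    ring
  rw [hA]
  have hB : (s * L / 2 - s * (Real.log (2 * π) + 1)) / π ≤ 0.15916 * s * L - 0.89 * s := by
    rw [div_le_iff₀ Real.pi_pos]
    have hsL : 0 ≤ s * L := by positivity
    nlinarith [mul_le_mul_of_nonneg_left h2π hs0.le]
  linarith

end Budget

open Budget

/-- **Crux `LiAsymptoticBudget` (K4; a closed real inequality).**  For `T ≥ 1000` and `n ≤ T²/4`:
`n ≥ 900 ⇒ liErrFar n T + liErrLow n + liErrSmooth n + liErrOscPlain n ≤ 2 √n log n` and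
`n ≥ 3·10⁵ ⇒ liErrFar n T + liErrLow n + liErrSmooth n + liErrOsc n ≤ (1/3) √n log n`. -/
theorem liAsymptoticBudget_bound :
    ∀ (n : ℕ) (T : ℝ), 1000 ≤ T → (n : ℝ) ≤ 1 / 4 * T ^ 2 →
      (900 ≤ n →
        Summit.RiemannHypothesis.RiemannHypothesis.Theorems.LiTheory.liErrFar n T
          + Summit.RiemannHypothesis.RiemannHypothesis.Theorems.LiTheory.liErrLow n
          + Summit.RiemannHypothesis.RiemannHypothesis.Theorems.LiTheory.liErrSmooth n
          + Summit.RiemannHypothesis.RiemannHypothesis.Theorems.LiTheory.liErrOscPlain n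
          ≤ 2 * Real.sqrt n * Real.log n) ∧
      (300000 ≤ n →
        Summit.RiemannHypothesis.RiemannHypothesis.Theorems.LiTheory.liErrFar n T
          + Summit.RiemannHypothesis.RiemannHypothesis.Theorems.LiTheory.liErrLow n
          + Summit.RiemannHypothesis.RiemannHypothesis.Theorems.LiTheory.liErrSmooth n
          + Summit.RiemannHypothesis.RiemannHypothesis.Theorems.LiTheory.liErrOsc n
          ≤ 1 / 3 * Real.sqrt n * Real.log n) := by
  intro n T hT hnc
  have hT0 : 0 < T := by linarith
  have key : ∀ (_ : 900 ≤ n), 30 ≤ Real.sqrt n ∧ 6.75 ≤ Real.log n ∧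
      liErrFar n T + liErrLow n + liErrSmooth n ≤
        0.16852 * Real.sqrt n * Real.log n - 0.877 * Real.sqrt n + 2.6216 * Real.log n + 17.519 := by
    intro hn
    have hnR : (900 : ℝ) ≤ n := by exact_mod_cast hn
    have hs30 : 30 ≤ Real.sqrt n := by
      rw [show (30 : ℝ) = Real.sqrt (30 ^ 2) by rw [Real.sqrt_sq (by norm_num)]]
      exact Real.sqrt_le_sqrt (by linarith)
    have hL : 6.75 ≤ Real.log n := log_900_ge.trans (Real.log_le_log (by norm_num) hnR)
    refine ⟨hs30, hL, ?_⟩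
    have h1 := liErrFar_le hn hnc hT0
    have h2 := liErrLow_le (le_trans (by norm_num) hn)
    unfold liErrSmooth
    linarith
  constructor
  · intro hn
    obtain ⟨hs, hL, h⟩ := key hn
    have hP1 : 6.75 * Real.sqrt n ≤ Real.sqrt n * Real.log n := by nlinarith
    have hP2 : 30 * Real.log n ≤ Real.sqrt n * Real.log n := by nlinarith
    unfold liErrOscPlain
    nlinarith
  · intro hn
    obtain ⟨-, -, h⟩ := key (le_trans (by norm_num) hn)
    have hnR : (300000 : ℝ) ≤ n := by exact_mod_cast hn
    have hs : 547 ≤ Real.sqrt n := by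
      rw [show (547 : ℝ) = Real.sqrt (547 ^ 2) by rw [Real.sqrt_sq (by norm_num)]]
      exact Real.sqrt_le_sqrt (by linarith)
    have hL : 12.5 ≤ Real.log n := log_300000_ge.trans (Real.log_le_log (by norm_num) hnR)
    have hP1 : 12.5 * Real.sqrt n ≤ Real.sqrt n * Real.log n := by nlinarith
    have hP2 : 547 * Real.log n ≤ Real.sqrt n * Real.log n := by nlinarith
    unfold liErrOsc
    nlinarith

/-- **Item `LiAsymptoticBudget` of route `LiAsymptotic` — PROVED** (FQ type, by name). -/
theorem liAsymptoticBudget_proof :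
    Summit.RiemannHypothesis.RiemannHypothesis.Theses.LiAsymptotic.LiAsymptoticBudget :=
  liAsymptoticBudget_bound

end Summit.RiemannHypothesis.RiemannHypothesis.Theorems.LiTheory

end
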